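import Summits.BirchSwinnertonDyer.BirchSwinnertonDyer.Theorems.SignedLowerHalvesSprungLowerDivisibilityAtThreeRankOneRealControl
import Summits.BirchSwinnertonDyer.Rank1Residual.Supersingular.SignedOrderOfVanishing
import Summits.BirchSwinnertonDyer.Rank1Residual.Additive.TameBranchBudgetSqueeze
import Literature.NumberTheory.EllipticCurves.GreenbergVatsal2000.CongruentCurves
import HarnessLib

/-!
# Route `SignedLowerHalves`, crux-5 child K1 `SprungLowerDivisibilityAtThree` (item
# stmt-BirchSwinnertonDyer-19875) at ANALYTIC RANK ONE, IMAGE-FREE: the Eisenstein half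
# `Theorems.SprungSharpFlatLowerDivisibility W 3 •` at every X8 pair with a tight certificate
# `(μ, λ)(L^•) = (0, 1)`, with NO hypothesis on the mod-`3` Galois image and NO Kato divisibility
# (cell `bsd-ssimc`, seat `bsd-ssimc-k3-c5` g12, object «K1-R1-IMAGEFREE»; `--supports … --as helper`)

PARTITION (cell bsd-ssimc): X8 (A8) ∩ {r_an = 1}, `p = 3`, surjective AND non-surjective `ρ̄_{E,3}`
alike (E11 ∪ the rank-one small-image part of the residual R8); types-the-object-of (K1 witnesses per
pair in Sprung's real currency); closes NONE; 0 census moves; BSD is not proved by any of this.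

## What this file proves, and why it needs less than `…RankOneReal.lean`

Seat g9's witnesses (`K1RankOne.sprungSharpFlatMainConjecture_of_lam_eq_one_of_analyticRank_eq_one`,
p492013; control discharged by kdot-split g5, p495829) prove the FULL Main Conjecture 7.21 at an
X8 ∧ Surj(3) ∧ `r_an = 1` pair from the certificate `(μ, λ)(L^•) = (0, 1)`: CONTROL gives `T ∣ gen`,
KATO (Sprung 2012 Thm. 7.16, integral under `Surj(3)` + Wuthrich L20) gives `gen ∣ L^•`, λ-squeeze.
Diagnosis: `Surj(3)` and Thm. 7.16 serve ONLY the Kato direction. The item's own predicate — the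
EISENSTEIN half K1, `ϖ·L^• ∣ gen` — needs neither: with `ord_{s=1} L(E,s) ≠ 0`, `μ(L^•) = 0`,
`λ(L^•) = 1` the tree theorem `Supersingular.X8.chromaticL_eq_X_mul_unit_of_analyticRank_eq_one`
(b2b, `SignedOrderOfVanishing.lean`: interpolation `L^•(0) = c_• · L(E,1)/Ω⁺_f = 0` + `Λ`-algebra)
gives `L^• = T · u`, `u ∈ Λˣ`, and CONTROL (`rank E(ℚ) = 1` by GZK ⇒ `Sel_{3^∞}(E/ℚ)` infinite ⇒
`X^•/TX^•` infinite by the kernel THEOREM `lem56AllN_sharpFlat_finite_selmer_of_finite_coinvariants_holds`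
⇒ `gen(0) = 0`, Greenberg L4.2) gives `T ∣ gen`; hence `ϖ·L^• ∣ gen` (`ϖ ∈ ℤ₃ˣ` on X8).
* §2 `sprungSharpFlatLowerDivisibility_of_lam_eq_one_of_analyticRank_eq_one_imageFree` — X8 ∧
  `r_an = 1` ∧ certificate ⇒ `SprungSharpFlatLowerDivisibility W 3 •`; named inputs Thm. 7.14
  (`h714`), the period unit at `3` (`h3`), GZK (`hGZK`); NO `Surj W 3`, NO Wuthrich L20, NO Thm. 7.16;
  variants `…_of_cert_at_conductor_…` and `…_sharp/flat_of_mazurTate_…` (ONE odd / even layer).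
* §3 the OTHER half at the same pairs is governed by `μ(X^•)` alone:
  `sprungSharpFlatMainConjecture_of_mu_eq_zero_of_lam_eq_one_of_analyticRank_eq_one` (Thm. 7.16's
  RATIONAL clause `gen ∣ 3ⁿ·L^•`, no image hypothesis, + displayed `μ(X^•) = 0` ⇒ Main Conj. 7.21 at
  the pair by Gauss' lemma; the ♯/♭ twin of seat k3-c4's
  `kobayashiMainConjecture_of_mu_eq_zero_of_cert_of_analyticRank_eq_one`) and conversely
  `mu_eq_zero_of_sharpFlatCharIdeal_eq_span` (a datum whose characteristic ideal is `(ϖ·L^•)` has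
  `μ = 0`; no Kato). In words: at a tight rank-one X8 pair K1^• holds (modulo `h714`, `h3`, GZK) and
  MC^• ⟺ `μ(X^•) = 0`.

HONEST STATUS: CONDITIONAL on the displayed published named facts and on the per-pair certificate
(`hcert` / `hcert₀` / a Mazur–Tate layer `Θ`; the cell's two-engine rows are not kernel terms); per
pair; closes nothing; K1 stays OPEN class-wide; no new engine; BSD is not proved by any of this.

References: [Sprung2012] Thm. 7.14, 7.16, Main Conj. 7.21 (pp. 1504–1505); [Sprung2017] Thm. 1.12,
Cor. 4.11; [Sprung2024] §5.2 Lemma 5.6 (p. 41); [GreenbergLNM1716] §4 Lemma 4.2; [GreenbergVatsal2000]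
p. 2 (1)–(2), p. 4; [KuriharaPollack2007] Prop. 1.5; [Pollack2003] Prop. 6.9–6.10; [Washington1997] §7.1.
-/

set_option autoImplicit false
-- justification: the mandated namespace `Summit.BirchSwinnertonDyer.BirchSwinnertonDyer.Theorems`
-- (single-conjunct summit, Sub = Summit) repeats a segment by design (D-0017).
set_option linter.dupNamespace false

noncomputable section

namespace Summit.BirchSwinnertonDyer.BirchSwinnertonDyer.Theorems.K1RankOne

open scoped Classical NumberField MatrixGroups ModularForm
open NumberField IsDedekindDomain WeierstrassCurve CongruenceSubgroup
  Literature.NumberTheory.EllipticCurves Literature.NumberTheory.EllipticCurves.ModularForms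
  Literature.NumberTheory.EllipticCurves.Rank1Residual
  Literature.NumberTheory.EllipticCurves.Rank1Residual.Typed
  Literature.NumberTheory.EllipticCurves.Sprung2017 Literature.NumberTheory.EllipticCurves.Sprung2012
  Literature.NumberTheory.EllipticCurves.Sprung2024
  Literature.NumberTheory.EllipticCurves.ZpExtension
  Literature.NumberTheory.EllipticCurves.GreenbergVatsal2000
  Summit.BirchSwinnertonDyer.Rank1Residual.X1.MuLambda
  Summit.BirchSwinnertonDyer.Rank1Residual.Supersingular
  Summit.BirchSwinnertonDyer.BirchSwinnertonDyer.Theorems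

/-! ### §1 `Λ`-algebra -/

section Algebra
variable {p : ℕ} [Fact p.Prime]

/-- **Rearrangement exhibiting `w · L ∣ gen`.** If `gen = T · g'` and `L = T · u` with `u ∈ Λˣ`, then
for every `w ∈ ℤ_pˣ`, `gen = C(w) · (L · (C(w⁻¹) · u⁻¹ · g'))`. [folklore] -/
theorem eq_C_mul_mul_of_eq_X_mul {gen g' L : IwasawaAlgebra p} (u : (IwasawaAlgebra p)ˣ) (w : ℤ_[p]ˣ)
    (hgen : gen = PowerSeries.X * g') (hL : L = PowerSeries.X * (u : IwasawaAlgebra p)) :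
    gen = PowerSeries.C (w : ℤ_[p]) *
      (L * (PowerSeries.C ((w⁻¹ : ℤ_[p]ˣ) : ℤ_[p]) * ((u⁻¹ : (IwasawaAlgebra p)ˣ) : IwasawaAlgebra p) *
        g')) := by
  have e1 : (PowerSeries.C (w : ℤ_[p]) : IwasawaAlgebra p) * PowerSeries.C ((w⁻¹ : ℤ_[p]ˣ) : ℤ_[p]) = 1 := by
    rw [← map_mul, Units.mul_inv, map_one]
  calc gen = ((PowerSeries.C (w : ℤ_[p]) : IwasawaAlgebra p) * PowerSeries.C ((w⁻¹ : ℤ_[p]ˣ) : ℤ_[p])) *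
        ((u : IwasawaAlgebra p) * ((u⁻¹ : (IwasawaAlgebra p)ˣ) : IwasawaAlgebra p)) *
          (PowerSeries.X * g') := by rw [e1, Units.mul_inv, one_mul, one_mul, hgen]
    _ = _ := by rw [hL]; ring

/-- `T · u`, `u ∈ Λˣ`, has unit content (coefficient of `T` is `u(0) ∈ ℤ_pˣ`). [cite: GreenbergVatsal2000, p. 2, (2)] -/
theorem hasUnitContent_X_mul_units (u : (IwasawaAlgebra p)ˣ) :
    HasUnitContent (PowerSeries.X * (u : IwasawaAlgebra p)) := by
  refine ⟨1, ?_⟩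
  rw [PowerSeries.coeff_succ_X_mul, PowerSeries.coeff_zero_eq_constantCoeff_apply]
  exact PowerSeries.isUnit_constantCoeff _ (Units.isUnit u)

/-- **Gauss'-lemma step.** If `T · g' ∣ C(p^n) · (T · u)`, `u ∈ Λˣ`, and `T · g'` has unit content, then
`g'` is a unit (`T·g' ∣ T·u` by `Additive.dvd_of_dvd_C_pow_mul_of_hasUnitContent`). [cite: Washington1997, §7.1] -/
theorem isUnit_of_X_mul_dvd_C_pow_mul_X_mul_units {g' : IwasawaAlgebra p} (u : (IwasawaAlgebra p)ˣ)
    {n : ℕ} (hdvd : PowerSeries.X * g' ∣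
      PowerSeries.C ((p : ℤ_[p]) ^ n) * (PowerSeries.X * (u : IwasawaAlgebra p)))
    (hu : HasUnitContent (PowerSeries.X * g')) : IsUnit g' := by
  have h1 : PowerSeries.X * g' ∣ PowerSeries.X * (u : IwasawaAlgebra p) :=
    Summit.BirchSwinnertonDyer.Rank1Residual.Additive.dvd_of_dvd_C_pow_mul_of_hasUnitContent hu n hdvd
  exact isUnit_of_dvd_unit ((mul_dvd_mul_iff_left (PowerSeries.X_ne_zero (R := ℤ_[p]))).mp h1)
    (Units.isUnit u)

end Algebra

/-- `r_an = 1` ⇒ `Sel_{p^∞}(E/ℚ)` infinite (GZK `rank E(ℚ) = 1`; finite Selmer ⇒ finitely many points).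
[cite: GrossZagier1986, Thm. (7.3)] [cite: Kolyvagin1990, Thm. A] -/
theorem not_finite_selmer_of_analyticRank_eq_one (hGZK : rank_eq_analyticRank_of_analyticRank_le_one)
    (W : WeierstrassCurve ℚ) [W.IsElliptic] {p : ℕ} [Fact p.Prime] (h1 : W.analyticRank = 1) :
    ¬ Finite (W.selmerGroupPInfty p) := by
  intro hfin
  have hrank : W.mordellWeilRank = 1 := (hGZK W (by omega)).1.trans h1
  haveI := hfin
  haveI : Finite W.toAffine.Point := W.finite_point_of_finite_selmerGroupPInfty p
  have h0 : W.mordellWeilRank = 0 := W.mordellWeilRank_eq_zero_iff_finite.mpr ‹_›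
  omega

/-! ### §2 K1 at a tight rank-one X8 pair, image-free and Kato-free -/

/-- **X8 ∧ `r_an = 1` ∧ `(μ, λ)(L^•) = (0, 1)` ⇒ the Eisenstein half K1
`SprungSharpFlatLowerDivisibility W 3 •`, with NO hypothesis on the Galois image and NO Kato
divisibility.** Named inputs (published): Sprung 2012 Thm. 7.14 (`h714`: `X^•` finitely generated
`Λ`-torsion), the period unit at `3` (`h3`), GZK (`hGZK`); CONTROL is the kernel theorem
`lem56AllN_sharpFlat_finite_selmer_of_finite_coinvariants_holds` (Sprung 2024 Lemma 5.6, surjectivity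
half). Displayed per pair: the class, `r_an = 1`, `hcert` (every newform `f` of `W`, every Sprung
pair — unique, Sprung 2017 Thm. 1.12: `μ(L^•) = 0`, `λ(L^•) = 1`). Proof: CONTROL ⇒ `gen = T·g'`; ORDER
OF VANISHING (`X8.chromaticL_eq_X_mul_unit_of_analyticRank_eq_one`) ⇒ `L^• = T·u`, `u ∈ Λˣ`;
`ϖ = w ∈ ℤ₃ˣ`; so `gen = w·L^•·h`, `h = C(w⁻¹)·u⁻¹·g'`. PER PAIR; closes nothing; K1 stays OPEN
class-wide. [cite: Sprung2012, Thm. 7.14 and Main Conj. 7.21 (pp. 1504–1505)]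
[cite: Sprung2017, Thm. 1.12 and Cor. 4.11] [cite: Sprung2024, §5.2 Lemma 5.6 (p. 41)]
[cite: GreenbergLNM1716, §4 Lemma 4.2 (p. 103)] [cite: KuriharaPollack2007, Prop. 1.5] -/
theorem sprungSharpFlatLowerDivisibility_of_lam_eq_one_of_analyticRank_eq_one_imageFree
    (h714 : thm714_sharpFlatSelmerDual_finite_torsion)
    (h3 : realPeriodRat_eq_unit_mul_plusPeriod_three)
    (hGZK : rank_eq_analyticRank_of_analyticRank_le_one)
    (W : WeierstrassCurve ℚ) [W.IsElliptic] [W.IsGloballyMinimal] (p : ℕ) [Fact p.Prime]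
    (hX : ClassX8 W p) (h1 : W.analyticRank = 1) (col : Chroma)
    (hcert : ∀ {N : ℕ} [NeZero N] (f : CuspForm (Gamma0 N) 2), IsNewformOf W f →
      ∀ Lsharp Lflat : IwasawaAlgebra p, IsSprungPair f p (W.frobeniusTrace p) Lsharp Lflat →
        mu (chromaticL col Lsharp Lflat) = 0 ∧ lam (chromaticL col Lsharp Lflat) = 1) :
    SprungSharpFlatLowerDivisibility W p col := by
  intro κ γ hκ hγ hγ' v hv g hg cneg c hc N hN f ϖ Lsharp Lflat hf hϖ hSP hcol D
  haveI := hN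
  have hp3 : p = 3 := hX.1
  subst hp3
  have hp2 : (3 : ℕ) ≠ 2 := by decide
  have hgood : W.HasGoodReductionAtPrime 3 := hX.2.1.1
  have hdvd : ((3 : ℕ) : ℤ) ∣ W.frobeniusTrace 3 := hX.2.1.2
  -- Sprung 2012 Thm. 7.14: `X^•` finitely generated and `Λ`-torsion
  obtain ⟨hfinD, htorD⟩ :=
    h714 W 3 hp2 hgood hdvd f hf κ γ hκ hγ hγ' v hv g hg cneg c hc col Lsharp Lflat hSP hcol D
  haveI := hfinD
  -- a generator of `char_Λ(X^•)` (`Λ` is a UFD)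
  obtain ⟨gen, hgen⟩ := (charIdeal_isPrincipal_holds 3 D.X).principal
  have hchar : D.charIdeal = Ideal.span {gen} := hgen
  -- CONTROL: `rank E(ℚ) = 1` ⇒ `Sel_{3^∞}(E/ℚ)` infinite ⇒ `X^•/TX^•` infinite ⇒ `gen(0) = 0`
  have hSel : ¬ Finite (W.selmerGroupPInfty 3) := not_finite_selmer_of_analyticRank_eq_one hGZK W h1
  have hgen0 : PowerSeries.constantCoeff gen = 0 := by
    by_contra h0
    refine hSel (lem56AllN_sharpFlat_finite_selmer_of_finite_coinvariants_holds W 3 hp2 hgood hdvd κ γ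
      hκ hγ hγ' v hv g hg cneg c hc col D ?_)
    exact IwasawaAlgebra.finite_coinvariants_of_constantCoeff_ne_zero 3 D.X htorD gen
      (by rw [show Module.charIdeal (IwasawaAlgebra 3) D.X = D.charIdeal from rfl, hchar]
          exact Ideal.mem_span_singleton_self gen) h0
  obtain ⟨g', hg'⟩ : (PowerSeries.X : IwasawaAlgebra 3) ∣ gen := PowerSeries.X_dvd_iff.mpr hgen0
  -- ORDER OF VANISHING: the certificate `(μ, λ)(L^•) = (0, 1)` and `r_an ≠ 0` give `L^• = T · u`
  obtain ⟨hμ, hlam⟩ := hcert f hf Lsharp Lflat hSP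
  obtain ⟨⟨u, hu⟩, -, -⟩ :=
    X8.chromaticL_eq_X_mul_unit_of_analyticRank_eq_one hX h1 hf hSP col hcol hμ hlam
  -- `ϖ` is a `3`-adic unit on X8
  have hϖ1 : ‖(ϖ : ℚ_[3])‖ = 1 := X8_norm_periodRatio_eq_one h3 W 3 hX hf hϖ
  refine ⟨gen, PowerSeries.C ((((PadicInt.mkUnits hϖ1)⁻¹ : ℤ_[3]ˣ) : ℤ_[3])) *
    ((u⁻¹ : (IwasawaAlgebra 3)ˣ) : IwasawaAlgebra 3) * g', hchar, ?_⟩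
  rw [eq_C_mul_mul_of_eq_X_mul u (PadicInt.mkUnits hϖ1) hg' hu,
    (span_C_units_mul_eq (PadicInt.mkUnits hϖ1) _).2, PadicInt.mkUnits_eq]

/-- **The same with the certificate stated for ONE newform `f₀` of level `N_E` only** (strong
multiplicity one across levels: `IsNewformOf.level_eq_conductorNorm_of_exists_conductorLevel`,
`IsNewformOf.unique`). PER PAIR; image-free; closes nothing.
[cite: Sprung2012, Main Conj. 7.21 (p. 1505)] [cite: Sprung2017, Thm. 1.12 and Cor. 4.11]
[cite: AtkinLehner1970, Thm. 4] -/
theorem sprungSharpFlatLowerDivisibility_of_cert_at_conductor_of_analyticRank_eq_one_imageFree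
    (h714 : thm714_sharpFlatSelmerDual_finite_torsion)
    (h3 : realPeriodRat_eq_unit_mul_plusPeriod_three)
    (hGZK : rank_eq_analyticRank_of_analyticRank_le_one)
    (W : WeierstrassCurve ℚ) [W.IsElliptic] [W.IsGloballyMinimal] (p : ℕ) [Fact p.Prime]
    (hX : ClassX8 W p) (h1 : W.analyticRank = 1) (col : Chroma)
    [NeZero (W.conductorNorm ℤ)] {f₀ : CuspForm (Gamma0 (W.conductorNorm ℤ)) 2} (hf₀ : IsNewformOf W f₀)
    (hcert₀ : ∀ Lsharp Lflat : IwasawaAlgebra p, IsSprungPair f₀ p (W.frobeniusTrace p) Lsharp Lflat →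
      mu (chromaticL col Lsharp Lflat) = 0 ∧ lam (chromaticL col Lsharp Lflat) = 1) :
    SprungSharpFlatLowerDivisibility W p col := by
  refine sprungSharpFlatLowerDivisibility_of_lam_eq_one_of_analyticRank_eq_one_imageFree h714 h3 hGZK
    W p hX h1 col ?_
  intro N _ f hf Lsharp Lflat hSP
  have hN : N = W.conductorNorm ℤ := IsNewformOf.level_eq_conductorNorm_of_exists_conductorLevel ⟨f₀, hf₀⟩ hf
  subst hN
  have hff : f = f₀ := hf.unique hf₀
  subst hff
  exact hcert₀ Lsharp Lflat hSP

/-- **Colour ♯ from ONE odd-level Mazur–Tate certificate, image-free**: for the newform `f₀` of level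
`N_E`, a non-zero `Θ ∈ Λ` with `ι Θ = θ_n(f₀)`, `n` odd, `μ(Θ) = 0`, `λ(Θ) = deg ω_n^+ + 1` (minimal
form, `lam_sharp_eq_of_mazurTate'`: then `(μ, λ)(L♯) = (0, 1)` for every Sprung pair of `f₀`) ⇒ K1 for
`L♯_3(E)` on the REAL `X^♯(E/ℚ_∞)`. PER PAIR; closes nothing.
[cite: Sprung2012, Main Conj. 7.21 (p. 1505)] [cite: Pollack2003, Prop. 6.9 and Prop. 6.10]
[cite: Sprung2017, §3, Cor. 3.6 and Thm. 1.12] -/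
theorem sprungSharpFlatLowerDivisibility_sharp_of_mazurTate_of_analyticRank_eq_one_imageFree
    (h714 : thm714_sharpFlatSelmerDual_finite_torsion)
    (h3 : realPeriodRat_eq_unit_mul_plusPeriod_three)
    (hGZK : rank_eq_analyticRank_of_analyticRank_le_one)
    (W : WeierstrassCurve ℚ) [W.IsElliptic] [W.IsGloballyMinimal] (p : ℕ) [Fact p.Prime]
    (hX : ClassX8 W p) (h1 : W.analyticRank = 1)
    [NeZero (W.conductorNorm ℤ)] {f₀ : CuspForm (Gamma0 (W.conductorNorm ℤ)) 2} (hf₀ : IsNewformOf W f₀)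
    {n : ℕ} (hn : Odd n) {Θ : IwasawaAlgebra p}
    (hΘ : iwasawaToPowerSeries p Θ =
      ((mazurTateElement f₀ p n).map (algebraMap ℚ ℚ_[p]) : PowerSeries ℚ_[p]))
    (hΘ0 : Θ ≠ 0) (hμ : mu Θ = 0) (hlam : lam Θ = (cyclotomicOmegaPlus p n).natDegree + 1) :
    SprungSharpFlatLowerDivisibility W p .sharp := by
  have hp2 : p ≠ 2 := by have := hX.1; omega
  have hgood : W.HasGoodReductionAtPrime p := by obtain ⟨hp3, hss, -⟩ := hX; subst hp3; exact hss.1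
  have hap : (p : ℤ) ∣ W.frobeniusTrace p := by obtain ⟨hp3, hss, -⟩ := hX; subst hp3; exact hss.2
  exact sprungSharpFlatLowerDivisibility_of_cert_at_conductor_of_analyticRank_eq_one_imageFree h714 h3
    hGZK W p hX h1 .sharp hf₀ fun Lsharp Lflat hSP ↦ by
      simpa only [chromaticL_sharp] using
        lam_sharp_eq_of_mazurTate' hp2 hf₀ hgood hap hSP hn hΘ hΘ0 hμ hlam

/-- **Colour ♭ from ONE even-level Mazur–Tate certificate, image-free** (`n` even,
`λ(Θ) = deg ω_n^- + 1`, `lam_flat_eq_of_mazurTate'`). PER PAIR; closes nothing.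
[cite: Sprung2012, Main Conj. 7.21 (p. 1505)] [cite: Pollack2003, Prop. 6.9 and Prop. 6.10]
[cite: Sprung2017, §3, Cor. 3.6 and Thm. 1.12] -/
theorem sprungSharpFlatLowerDivisibility_flat_of_mazurTate_of_analyticRank_eq_one_imageFree
    (h714 : thm714_sharpFlatSelmerDual_finite_torsion)
    (h3 : realPeriodRat_eq_unit_mul_plusPeriod_three)
    (hGZK : rank_eq_analyticRank_of_analyticRank_le_one)
    (W : WeierstrassCurve ℚ) [W.IsElliptic] [W.IsGloballyMinimal] (p : ℕ) [Fact p.Prime]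
    (hX : ClassX8 W p) (h1 : W.analyticRank = 1)
    [NeZero (W.conductorNorm ℤ)] {f₀ : CuspForm (Gamma0 (W.conductorNorm ℤ)) 2} (hf₀ : IsNewformOf W f₀)
    {n : ℕ} (hn : Even n) {Θ : IwasawaAlgebra p}
    (hΘ : iwasawaToPowerSeries p Θ =
      ((mazurTateElement f₀ p n).map (algebraMap ℚ ℚ_[p]) : PowerSeries ℚ_[p]))
    (hΘ0 : Θ ≠ 0) (hμ : mu Θ = 0) (hlam : lam Θ = (cyclotomicOmegaMinus p n).natDegree + 1) :
    SprungSharpFlatLowerDivisibility W p .flat := by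
  have hp2 : p ≠ 2 := by have := hX.1; omega
  have hgood : W.HasGoodReductionAtPrime p := by obtain ⟨hp3, hss, -⟩ := hX; subst hp3; exact hss.1
  have hap : (p : ℤ) ∣ W.frobeniusTrace p := by obtain ⟨hp3, hss, -⟩ := hX; subst hp3; exact hss.2
  exact sprungSharpFlatLowerDivisibility_of_cert_at_conductor_of_analyticRank_eq_one_imageFree h714 h3
    hGZK W p hX h1 .flat hf₀ fun Lsharp Lflat hSP ↦ by
      simpa only [chromaticL_flat] using
        lam_flat_eq_of_mazurTate' hp2 hf₀ hgood hap hSP hn hΘ hΘ0 hμ hlam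

/-! ### §3 The Kato half at the same pairs is exactly `μ(X^•) = 0` -/

/-- **IMAGE-FREE Main Conjecture 7.21 at a tight rank-one X8 pair from `μ(X^•) = 0`.** X8,
`r_an = 1`, certificate `(μ, λ)(L^•) = (0, 1)`, and `μ = 0` for every dual datum of `Sel^•(E/ℚ_∞)` in
the conjecture's own setting (`hμX`, displayed); granted BY NAME Thm. 7.14 (`h714`), Thm. 7.16's
RATIONAL clause only (`h716`: `gen ∣ 3ⁿ·L^•` for some `n`, NO image hypothesis), the period unit at
`3` (`h3`), GZK (`hGZK`): `SprungSharpFlatMainConjecture W 3 •`. Proof: `gen = T·g'`, `L^• = T·u`;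
`gen ∣ 3ⁿ·T·u` + unit content of `gen` (`μ(X^•) = 0`, `muInvariant_eq_zero_iff_hasUnitContent`) ⇒
`g' ∈ Λˣ` (Gauss), so `(gen) = (ϖ·L^•)`. ♯/♭ twin of k3-c4's `kobayashiMainConjecture_of_mu_eq_zero_…`.
PER PAIR; CONDITIONAL on the displayed binders; closes nothing.
[cite: Sprung2012, Thm. 7.14, Thm. 7.16 and Main Conj. 7.21 (pp. 1504–1505)]
[cite: GreenbergVatsal2000, p. 2 (1)–(2) and p. 4] [cite: Washington1997, §7.1] -/
theorem sprungSharpFlatMainConjecture_of_mu_eq_zero_of_lam_eq_one_of_analyticRank_eq_one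
    (h714 : thm714_sharpFlatSelmerDual_finite_torsion)
    (h716 : thm716_sharpFlatCharIdeal_divisibility)
    (h3 : realPeriodRat_eq_unit_mul_plusPeriod_three)
    (hGZK : rank_eq_analyticRank_of_analyticRank_le_one)
    (W : WeierstrassCurve ℚ) [W.IsElliptic] [W.IsGloballyMinimal] (p : ℕ) [Fact p.Prime]
    (hX : ClassX8 W p) (h1 : W.analyticRank = 1) (col : Chroma)
    (hμX : ∀ (κ : ZpExtension ℚ p) (γ : Field.absoluteGaloisGroup ℚ),
        κ.IsCyclotomic → κ.IsTopGenerator γ → IsCyclotomicVariable p γ →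
      ∀ (v : HeightOneSpectrum (𝓞 ℚ)), (p : 𝓞 ℚ) ∈ v.asIdeal →
      ∀ (g : Field.absoluteGaloisGroup (v.adicCompletion ℚ)),
        κ.IsTopGenerator (resGalOfEmb (closureEmb (K := ℚ) (v.adicCompletion ℚ)) g) →
      ∀ (c : ℕ → localPoints W (v.adicCompletion ℚ))
        (D : SharpFlatSelmerDualData W κ γ (closureEmb (K := ℚ) (v.adicCompletion ℚ))
          (W.frobeniusTrace p) g c col), D.mu = 0)
    (hcert : ∀ {N : ℕ} [NeZero N] (f : CuspForm (Gamma0 N) 2), IsNewformOf W f →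
      ∀ Lsharp Lflat : IwasawaAlgebra p, IsSprungPair f p (W.frobeniusTrace p) Lsharp Lflat →
        mu (chromaticL col Lsharp Lflat) = 0 ∧ lam (chromaticL col Lsharp Lflat) = 1) :
    SprungSharpFlatMainConjecture W p col := by
  intro κ γ hκ hγ hγ' v hv g hg cneg c hc N hN f ϖ Lsharp Lflat hf hϖ hSP hcol D
  haveI := hN
  have hp3 : p = 3 := hX.1
  subst hp3
  have hp2 : (3 : ℕ) ≠ 2 := by decide
  have hgood : W.HasGoodReductionAtPrime 3 := hX.2.1.1
  have hdvd : ((3 : ℕ) : ℤ) ∣ W.frobeniusTrace 3 := hX.2.1.2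
  obtain ⟨hfinD, htorD⟩ :=
    h714 W 3 hp2 hgood hdvd f hf κ γ hκ hγ hγ' v hv g hg cneg c hc col Lsharp Lflat hSP hcol D
  haveI := hfinD
  obtain ⟨gen, hgen⟩ := (charIdeal_isPrincipal_holds 3 D.X).principal
  have hchar : D.charIdeal = Ideal.span {gen} := hgen
  -- CONTROL ⇒ `gen = T · g'`
  have hSel : ¬ Finite (W.selmerGroupPInfty 3) := not_finite_selmer_of_analyticRank_eq_one hGZK W h1
  have hgen0 : PowerSeries.constantCoeff gen = 0 := by
    by_contra h0
    refine hSel (lem56AllN_sharpFlat_finite_selmer_of_finite_coinvariants_holds W 3 hp2 hgood hdvd κ γ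
      hκ hγ hγ' v hv g hg cneg c hc col D ?_)
    exact IwasawaAlgebra.finite_coinvariants_of_constantCoeff_ne_zero 3 D.X htorD gen
      (by rw [show Module.charIdeal (IwasawaAlgebra 3) D.X = D.charIdeal from rfl, hchar]
          exact Ideal.mem_span_singleton_self gen) h0
  obtain ⟨g', hg'⟩ : (PowerSeries.X : IwasawaAlgebra 3) ∣ gen := PowerSeries.X_dvd_iff.mpr hgen0
  -- ORDER OF VANISHING ⇒ `L^• = T · u`
  obtain ⟨hμ, hlam⟩ := hcert f hf Lsharp Lflat hSP
  obtain ⟨⟨u, hu⟩, -, -⟩ :=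
    X8.chromaticL_eq_X_mul_unit_of_analyticRank_eq_one hX h1 hf hSP col hcol hμ hlam
  -- KATO, RATIONAL clause: `gen ∣ 3ⁿ · L^•`
  obtain ⟨n, hn⟩ := h716.exists_dvd_pow_mul hp2 hgood hdvd hf hκ hγ hγ' hv hg hc hSP hcol D htorD hchar
  have hC : (((3 : ℕ) : IwasawaAlgebra 3) ^ n : IwasawaAlgebra 3) = PowerSeries.C (((3 : ℕ) : ℤ_[3]) ^ n) := by
    rw [map_pow, map_natCast]
  rw [hC, hu] at hn
  rw [hg'] at hn
  -- `μ(X^•) = 0` ⇒ unit content of `gen` ⇒ `g'` is a unit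
  have hug : HasUnitContent gen :=
    (muInvariant_eq_zero_iff_hasUnitContent D.X htorD hchar).mp (hμX κ γ hκ hγ hγ' v hv g hg c D)
  rw [hg'] at hug
  have hg'u : IsUnit g' := isUnit_of_X_mul_dvd_C_pow_mul_X_mul_units u hn hug
  -- `(gen) = (L^•)`
  have hspan : Ideal.span ({gen} : Set (IwasawaAlgebra 3)) = Ideal.span {chromaticL col Lsharp Lflat} := by
    rw [hg', hu]
    exact Ideal.span_singleton_eq_span_singleton.mpr
      ⟨hg'u.unit⁻¹ * u, by rw [Units.val_mul, ← mul_assoc, mul_assoc PowerSeries.X, IsUnit.mul_val_inv, mul_one]⟩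
  have hϖ1 : ‖(ϖ : ℚ_[3])‖ = 1 := X8_norm_periodRatio_eq_one h3 W 3 hX hf hϖ
  obtain ⟨hspan', hι⟩ := span_C_units_mul_eq (PadicInt.mkUnits hϖ1) (chromaticL col Lsharp Lflat)
  refine ⟨htorD, PowerSeries.C ((PadicInt.mkUnits hϖ1 : ℤ_[3]ˣ) : ℤ_[3]) *
    chromaticL col Lsharp Lflat, ?_, ?_⟩
  · rw [hchar, hspan, hspan']
  · rw [hι, PadicInt.mkUnits_eq]

/-- **Conversely, MC^• at a tight rank-one X8 pair forces `μ(X^•) = 0`** — no Kato, no image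
hypothesis: in the setting of the conjecture, for a datum `D` of `Sel^•(E/ℚ_∞)` whose characteristic
ideal is generated by `gen` with `ι gen = ϖ · ι L^•` (the conclusion of Main Conj. 7.21 at the pair),
`D.mu = 0`: indeed `gen = w · L^• = w · T · u` (`ι` injective, `ϖ = w ∈ ℤ₃ˣ`, order of vanishing) has
unit content, and `μ = 0 ⟺` unit content (Greenberg–Vatsal (1)–(2),
`muInvariant_eq_zero_iff_hasUnitContent`; `X^•` f.g. torsion by Thm. 7.14). With §2–§3: at such a pair
K1^• holds and MC^• ⟺ `μ(X^•) = 0`. PER PAIR; closes nothing.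
[cite: Sprung2012, Thm. 7.14 and Main Conj. 7.21 (pp. 1504–1505)] [cite: GreenbergVatsal2000, p. 2 (1)–(2)]
[cite: Sprung2017, Thm. 1.12 and Cor. 4.11] -/
theorem mu_eq_zero_of_sharpFlatCharIdeal_eq_span
    (h714 : thm714_sharpFlatSelmerDual_finite_torsion)
    (h3 : realPeriodRat_eq_unit_mul_plusPeriod_three)
    (W : WeierstrassCurve ℚ) [W.IsElliptic] [W.IsGloballyMinimal] (p : ℕ) [Fact p.Prime]
    (hX : ClassX8 W p) (h1 : W.analyticRank = 1) (col : Chroma)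
    {κ : ZpExtension ℚ p} {γ : Field.absoluteGaloisGroup ℚ}
    (hκ : κ.IsCyclotomic) (hγ : κ.IsTopGenerator γ) (hγ' : IsCyclotomicVariable p γ)
    {v : HeightOneSpectrum (𝓞 ℚ)} (hv : (p : 𝓞 ℚ) ∈ v.asIdeal)
    {g : Field.absoluteGaloisGroup (v.adicCompletion ℚ)}
    (hg : κ.IsTopGenerator (resGalOfEmb (closureEmb (K := ℚ) (v.adicCompletion ℚ)) g))
    {cneg : localPoints W (v.adicCompletion ℚ)} {c : ℕ → localPoints W (v.adicCompletion ℚ)}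
    (hc : IsHondaSystem κ (closureEmb (K := ℚ) (v.adicCompletion ℚ)) W (W.frobeniusTrace p) g cneg c)
    {N : ℕ} [NeZero N] {f : CuspForm (Gamma0 N) 2} {ϖ : ℚ} {Lsharp Lflat : IwasawaAlgebra p}
    (hf : IsNewformOf W f) (hϖ : (ϖ : ℝ) * W.realPeriodRat = plusPeriod f)
    (hSP : IsSprungPair f p (W.frobeniusTrace p) Lsharp Lflat)
    (hμ : mu (chromaticL col Lsharp Lflat) = 0) (hlam : lam (chromaticL col Lsharp Lflat) = 1)
    (D : SharpFlatSelmerDualData W κ γ (closureEmb (K := ℚ) (v.adicCompletion ℚ))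
      (W.frobeniusTrace p) g c col)
    {gen : IwasawaAlgebra p} (hchar : D.charIdeal = Ideal.span {gen})
    (hgen : iwasawaToPowerSeries p gen =
      PowerSeries.C (ϖ : ℚ_[p]) * iwasawaToPowerSeries p (chromaticL col Lsharp Lflat)) :
    D.mu = 0 := by
  have hp3 : p = 3 := hX.1
  subst hp3
  have hp2 : (3 : ℕ) ≠ 2 := by decide
  have hgood : W.HasGoodReductionAtPrime 3 := hX.2.1.1
  have hdvd : ((3 : ℕ) : ℤ) ∣ W.frobeniusTrace 3 := hX.2.1.2
  have hcol : chromaticL col Lsharp Lflat ≠ 0 :=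
    ne_zero_of_lam_ne_zero (by rw [hlam]; exact one_ne_zero)
  obtain ⟨hfinD, htorD⟩ :=
    h714 W 3 hp2 hgood hdvd f hf κ γ hκ hγ hγ' v hv g hg cneg c hc col Lsharp Lflat hSP hcol D
  haveI := hfinD
  -- `L^• = T · u`
  obtain ⟨⟨u, hu⟩, -, -⟩ :=
    X8.chromaticL_eq_X_mul_unit_of_analyticRank_eq_one hX h1 hf hSP col hcol hμ hlam
  -- `gen = w · L^•`, `w = ϖ ∈ ℤ₃ˣ`, by injectivity of `ι`
  have hϖ1 : ‖(ϖ : ℚ_[3])‖ = 1 := X8_norm_periodRatio_eq_one h3 W 3 hX hf hϖ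
  obtain ⟨-, hι⟩ := span_C_units_mul_eq (PadicInt.mkUnits hϖ1) (chromaticL col Lsharp Lflat)
  rw [PadicInt.mkUnits_eq] at hι
  have hgen' : gen = PowerSeries.C ((PadicInt.mkUnits hϖ1 : ℤ_[3]ˣ) : ℤ_[3]) *
      chromaticL col Lsharp Lflat :=
    iwasawaToPowerSeries_injective 3 (hgen.trans hι.symm)
  -- unit content of `gen`, hence `μ = 0`
  have hug : HasUnitContent gen := by
    rw [hgen', hasUnitContent_unit_mul_iff ((Units.isUnit _).map PowerSeries.C), hu]
    exact hasUnitContent_X_mul_units u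
  exact (muInvariant_eq_zero_iff_hasUnitContent D.X htorD hchar).mpr hug

end Summit.BirchSwinnertonDyer.BirchSwinnertonDyer.Theorems.K1RankOne

end
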